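import Summits.Ventures.HSemireg.Mod4CarrierMiddleDegree
import Summits.Ventures.HSemireg.Mod4CarrierMiddleMatrix
import Summits.Ventures.HSemireg.WedgeWeilCarrierRank

/-!
# Venture HSemireg — MOD-4 line: THEOREM R_Z (the CARRIER rows of TABLE R) ON THE p4 CARRIER, every `n`
# (`v = c·Θⁿ/n! + a·w₊ + b·w₋`: side degrees `(k+3)C(2n,k) − 2(k+1)C(n,k)`, middle degree `(n+3)C(2n,n) − 2(n+1) − #{m : c²C(n,m)² = ab}`)

HONEST FRAMING. Part of the Lean index of the computation cell `pub-hsemireg` (widening group W3, seat w3-mod4-1 gen 6; file of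
record `HOME/widen/W3/MOD4-OFFSPLIT-w3mod4.md` §10.2 (C1) / §12).  Finite-dimensional exterior algebra over a field ONLY (p4's carrier,
th-7's wedge model, seat g4/g5's explicit middle matrix `Mod4.middleM`): no abelian variety, no sheaf, no Ext group, no semiregularity
map; nothing here says that HC, HC_CM or HC_AV holds; no Literature fact is declared or used.  WHAT IS PROVED (proof-only; no
definitions).  The CARRIER h-part is `q = c·δ_n` (`q_i = [i = n]·c`), i.e. `Ecl q (2n) = c·Θⁿ/n!` on p4's carrier (the h-part of the
class of a middle-dimensional cycle `q_n hⁿ/n! + w`, MOD4-OFFSPLIT THEOREM R_Z).  (1) `hankel1_rank_carrier`: its Hankel ranks are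
`r_k = rank H_k(c·δ_n) = k + 1` for `k ≤ n`, `c ≠ 0` (`H_k H_kᵀ = c²·1`).  (2) **THEOREM R_Z ON THE CARRIER, SIDE DEGREES**
(`finrank_S_carrier_nn_deg`, `1 ≤ k ≤ n − 1`, `a, b, c ≠ 0`): `dim S_k(c·Θⁿ/n! + a·w₊ + b·w₋) + 2(k+1)·C(n,k) = (k+3)·C(2n,k)` (p4's
`WeilCarrier.finrank_S_weil_nn_deg` ← th-7's `weilRank_nn_deg`, with (1)).  (3) **THEOREM R_Z ON THE CARRIER, MIDDLE DEGREE**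
(`finrank_S_carrier_nn_middle`, every field, every `n ≥ 1`, `a, b, c ≠ 0`):
`dim S_n(c·Θⁿ/n! + a·w₊ + b·w₋) + 2(n+1) + #{m ≤ n : c²·C(n,m)² = ab} = (n+3)·C(2n,n)` (seat g6's `finrank_S_weil_nn_middle'` +
seat g5's `Mod4Site.finrank_ker_middleM_carrier`: `M_f = diag((−1)ⁿc²C(n,m)²)`), and the same with the drop set read off the carrier's
top forms, `#{m : (−1)ⁿc²C(n,m)² = t}` for `(a·w₊)∧(b·w₋) = t·Θ^{2n}/(2n)!` (`finrank_S_carrier_nn_middle_of_top`).  READING (MOD4-OFFSPLIT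
(C1), dictionary not asserted in Lean): `ab = τ = (w,w)_χ/(2D)` on the carrier, so the middle drop is `#{m : C(n,m)²·q_n² = τ}` — the
carrier profiles `(1,8,24−,8,1)`, `(1,12,57,112−,57,12,1)`, `(1,16,104,304,480−,…)` with drops `∈ {0,1,2}` at `τ/q_n² = C(n,m)²`.
(4) THE WEIL SIXFOLD CARRIER ROW explicitly (`n = 3`, `a, b, c ≠ 0`): `dim S₃(c·Θ³/3! + a·w₊ + b·w₋) = 112` off the loci
`ab ∈ {c², 9c²}` (`finrank_S_carrier_sixfold`) and `= 110` on each locus in characteristic `≠ 2` (`…_locus_one`, `…_locus_nine`) —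
MOD4-OFFSPLIT's `(1,12,57,112 ∣ 110,57,12,1)` with drops at `t ∈ {1, 9}` (seat g5's `decide`d instances, now on the carrier);
(5) THE WEIL EIGHTFOLD CARRIER ROW (`n = 4`): `dim S₄(c·Θ⁴/4! + a·w₊ + b·w₋) = 480` off `ab ∈ {c², 16c², 36c²}`, and in characteristic `0`:
`479` on `ab = 36c²`, `478` on `ab = c²` and on `ab = 16c²` — MOD4-OFFSPLIT's `(1,16,104,304,480 ∣ 478 ∣ 479,…)` (the fourfold row `(1,8,24 ∣ 22 ∣ 23,8,1)` follows the same way from `finrank_S_carrier_nn_middle` at `n = 2`).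
All statements and proofs: w3-mod4-1 g6 (2026-08-23).  Namespace `Summit.Ventures.HSemireg.Mod4Carrier`.
References: [BourbakiAlgebre1a3] Ch. III §7, §11 no. 9; [BuchweitzFlenner2008HH] Prop. 6.4.4 (why these operators).
-/

open Module

namespace Summit.Ventures.HSemireg.Mod4Carrier

open Summit.Ventures.HSemireg.WedgeBridge Summit.Ventures.HSemireg.WeilCarrier
open Summit.Ventures.HSemireg.Wedge.Hankel Summit.Ventures.HSemireg.Mod4 Summit.Ventures.HSemireg.Mod4Site

variable {K : Type*} [Field K]

/-! ### 1. The carrier Hankel ranks `r_k = k + 1` -/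

/-- the CARRIER Hankel matrix `H_k(c·δ_n)` (`q_i = [i = n]·c`, `2n` pairs, `k ≤ n`) times its transpose is `c²·1`:
row `i` has the single entry `c` in column `n − i`. -/
lemma hankel1_carrier_mul_transpose {n k : ℕ} (hk : k ≤ n) (c : K) :
    hankel1 K (n + n) k (fun i => if i = n then c else 0) * (hankel1 K (n + n) k (fun i => if i = n then c else 0)).transpose =
      (c * c) • (1 : Matrix (Fin (k + 1)) (Fin (k + 1)) K) := by
  ext i j
  simp only [Matrix.mul_apply, Matrix.transpose_apply, hankel1, Matrix.of_apply, Matrix.smul_apply, Matrix.one_apply,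
    smul_eq_mul, mul_ite, mul_one, mul_zero]
  by_cases hij : i = j
  · subst hij
    rw [if_pos rfl]
    have hs : n - (i : ℕ) < n + n + 1 - k := by have := i.2; omega
    rw [Finset.sum_eq_single ⟨n - (i : ℕ), hs⟩]
    · have hi : (i : ℕ) + (n - (i : ℕ)) = n := by have := i.2; omega
      simp only [hi, if_true]
    · intro s _ hs'
      have : (i : ℕ) + (s : ℕ) ≠ n := fun h => hs' (Fin.ext (by simp only; omega))
      simp only [this, if_false]
    · intro h; exact absurd (Finset.mem_univ _) h
  · rw [if_neg hij]
    refine Finset.sum_eq_zero fun s _ => ?_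
    by_cases h1 : (i : ℕ) + (s : ℕ) = n <;> by_cases h2 : (j : ℕ) + (s : ℕ) = n
    · exact absurd (Fin.ext (by omega)) hij
    all_goals simp [h1, h2]

/-- **the carrier Hankel rank:** `rank H_k(c·δ_n) = k + 1` for `k ≤ n`, `c ≠ 0` (THEOREM R_Z's `r_k = k + 1`). -/
theorem hankel1_rank_carrier {n k : ℕ} (hk : k ≤ n) {c : K} (hc : c ≠ 0) :
    (hankel1 K (n + n) k (fun i => if i = n then c else 0)).rank = k + 1 := by
  apply le_antisymm
  · exact (Matrix.rank_le_card_height _).trans (by rw [Fintype.card_fin])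
  · have h := Matrix.rank_mul_le_left (hankel1 K (n + n) k (fun i => if i = n then c else 0))
      (hankel1 K (n + n) k (fun i => if i = n then c else 0)).transpose
    rw [hankel1_carrier_mul_transpose hk c] at h
    have hu : IsUnit ((c * c) • (1 : Matrix (Fin (k + 1)) (Fin (k + 1)) K)) := by
      rw [Matrix.isUnit_iff_isUnit_det, Matrix.det_smul, Matrix.det_one, mul_one, Fintype.card_fin]
      exact (pow_ne_zero _ (mul_ne_zero hc hc)).isUnit
    rw [Matrix.rank_of_isUnit _ hu, Fintype.card_fin] at h
    exact h

/-! ### 2. THEOREM R_Z on the carrier: side degrees -/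

section Carrier

variable {n : ℕ} {V : Type*} [AddCommGroup V] [Module K V] (bV : Basis (Fin ((n + n) + (n + n))) K V)

/-- **THEOREM R_Z ON THE CARRIER, SIDE DEGREES** (`1 ≤ k`, `k + 1 ≤ n`, `a, b, c ≠ 0`):
`dim S_k(c·Θⁿ/n! + a·w₊ + b·w₋) + 2(k+1)·C(n,k) = (k+3)·C(2n,k)`. [cite: BuchweitzFlenner2008HH, Prop. 6.4.4] -/
theorem finrank_S_carrier_nn_deg {k : ℕ} (hk1 : 1 ≤ k) (hkn : k + 1 ≤ n) {c a b : K} (hc : c ≠ 0) (ha : a ≠ 0) (hb : b ≠ 0) :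
    Module.finrank K (S K (Lsp bV) k (Ecl bV (fun i => if i = n then c else 0) (n + n) + a • wUp bV n + b • wLow bV n)) +
        2 * (k + 1) * n.choose k = (k + 3) * (n + n).choose k := by
  have h := finrank_S_weil_nn_deg bV hk1 hkn (fun i => if i = n then c else 0) ha hb
  rw [hankel1_rank_carrier (by omega) hc] at h
  linarith [h]

/-! ### 3. THEOREM R_Z on the carrier: the middle degree -/

/-- the kernel term of `finrank_S_weil_nn_middle'` in `mulVecLin` form. -/
lemma finrank_ker_toLin'_sub_smul (M : Matrix (Fin (n + 1)) (Fin (n + 1)) K) (t : K) :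
    Module.finrank K (LinearMap.ker (Matrix.toLin' M - t • LinearMap.id)) =
      Module.finrank K (LinearMap.ker (M - t • (1 : Matrix (Fin (n + 1)) (Fin (n + 1)) K)).mulVecLin) := by
  rw [← Matrix.toLin'_apply', map_sub, map_smul, Matrix.toLin'_one]

/-- **THEOREM R_Z ON THE CARRIER, MIDDLE DEGREE** (every field, every `n ≥ 1`, `a, b, c ≠ 0`):
`dim S_n(c·Θⁿ/n! + a·w₊ + b·w₋) + 2(n+1) + #{m : c²·C(n,m)² = ab} = (n+3)·C(2n,n)`. [cite: BuchweitzFlenner2008HH, Prop. 6.4.4] -/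
theorem finrank_S_carrier_nn_middle [DecidableEq K] (hn : 1 ≤ n) {c a b : K} (hc : c ≠ 0) (ha : a ≠ 0) (hb : b ≠ 0) :
    Module.finrank K (S K (Lsp bV) n (Ecl bV (fun i => if i = n then c else 0) (n + n) + a • wUp bV n + b • wLow bV n)) +
        2 * (n + 1) + (Finset.univ.filter fun m : Fin (n + 1) => c ^ 2 * (n.choose (m : ℕ) : K) ^ 2 = a * b).card =
      (n + 3) * (n + n).choose n := by
  have h := finrank_S_weil_nn_middle' bV hn (fun i => if i = n then c else 0) ha hb
  rw [hankel1_rank_carrier (le_refl n) hc, finrank_ker_toLin'_sub_smul, finrank_ker_middleM_carrier] at h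
  have hfilter : (Finset.univ.filter fun m : Fin (n + 1) => (-1 : K) ^ n * c ^ 2 * (n.choose (m : ℕ) : K) ^ 2 = (-1 : K) ^ n * (a * b))
      = Finset.univ.filter fun m : Fin (n + 1) => c ^ 2 * (n.choose (m : ℕ) : K) ^ 2 = a * b := by
    refine Finset.filter_congr fun m _ => ?_
    rw [mul_assoc]
    exact (mul_right_injective₀ (pow_ne_zero _ (neg_ne_zero.mpr one_ne_zero))).eq_iff
  rw [hfilter] at h
  linarith [h]

/-- the same with the drop set READ OFF THE CARRIER: if `(a·w₊)∧(b·w₋) = t·Θ^{2n}/(2n)!` then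
`dim S_n(c·Θⁿ/n! + a·w₊ + b·w₋) + 2(n+1) + #{m : (−1)ⁿc²·C(n,m)² = t} = (n+3)·C(2n,n)` — (C1)'s drop count `#{m : C(n,m)²q_n² = τ}` with
`t = (−1)ⁿτ`. [cite: BuchweitzFlenner2008HH, Prop. 6.4.4] -/
theorem finrank_S_carrier_nn_middle_of_top [DecidableEq K] (hn : 1 ≤ n) {c a b t : K} (hc : c ≠ 0) (ha : a ≠ 0) (hb : b ≠ 0)
    (ht : (a • wUp bV n) * (b • wLow bV n) = t • LMprod bV (n + n)) :
    Module.finrank K (S K (Lsp bV) n (Ecl bV (fun i => if i = n then c else 0) (n + n) + a • wUp bV n + b • wLow bV n)) +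
        2 * (n + 1) + (Finset.univ.filter fun m : Fin (n + 1) => (-1 : K) ^ n * c ^ 2 * (n.choose (m : ℕ) : K) ^ 2 = t).card =
      (n + 3) * (n + n).choose n := by
  have h := finrank_S_weil_nn_middle_of_top bV hn (fun i => if i = n then c else 0) ha hb ht
  rw [hankel1_rank_carrier (le_refl n) hc, finrank_ker_toLin'_sub_smul, finrank_ker_middleM_carrier] at h
  linarith [h]

end Carrier


/-- `k·c² ≠ 0` for `k ≠ 0` in characteristic `0`, `c ≠ 0`. -/
lemma natCast_mul_sq_ne_zero [CharZero K] {c : K} (hc : c ≠ 0) {k : ℕ} (hk : k ≠ 0) : (k : K) * c ^ 2 ≠ 0 :=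
  mul_ne_zero (Nat.cast_ne_zero.mpr hk) (pow_ne_zero 2 hc)

/-! ### 4. The Weil SIXFOLD carrier row (`n = 3`): `(1, 12, 57, 112 ∣ 110, 57, 12, 1)` -/

section Sixfold

variable [DecidableEq K]

omit [DecidableEq K] in
/-- `8c² ≠ 0` in characteristic `≠ 2`. -/
lemma eight_mul_sq_ne_zero {c : K} (hc : c ≠ 0) (h2 : (2 : K) ≠ 0) : (8 : K) * c ^ 2 ≠ 0 := by
  have : (8 : K) = 2 ^ 3 := by norm_num
  rw [this]; exact mul_ne_zero (pow_ne_zero 3 h2) (pow_ne_zero 2 hc)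

/-- the sixfold carrier drop set off the two loci is empty. -/
lemma carrier_drop_six_generic {c a b : K} (h1 : a * b ≠ c ^ 2) (h9 : a * b ≠ 9 * c ^ 2) :
    (Finset.univ.filter fun m : Fin (3 + 1) => c ^ 2 * (Nat.choose 3 (m : ℕ) : K) ^ 2 = a * b).card = 0 := by
  rw [Finset.card_eq_zero, Finset.filter_eq_empty_iff]
  intro m _
  fin_cases m
  all_goals norm_num [Nat.choose]
  all_goals intro e
  all_goals first
    | exact h1 (by linear_combination (-1 : K) * e)
    | exact h9 (by linear_combination (-1 : K) * e)

/-- the sixfold carrier drop set on the locus `ab = c²` (`c ≠ 0`, characteristic `≠ 2`) is `{m : C(3,m) = 1}`: two elements. -/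
lemma carrier_drop_six_one {c a b : K} (hc : c ≠ 0) (h2 : (2 : K) ≠ 0) (hab : a * b = c ^ 2) :
    (Finset.univ.filter fun m : Fin (3 + 1) => c ^ 2 * (Nat.choose 3 (m : ℕ) : K) ^ 2 = a * b).card = 2 := by
  have hne : ¬ c ^ 2 * 9 = c ^ 2 := fun e => eight_mul_sq_ne_zero hc h2 (by linear_combination e)
  have hP : ∀ m : Fin (3 + 1), (c ^ 2 * (Nat.choose 3 (m : ℕ) : K) ^ 2 = a * b) ↔ ((m : ℕ) = 0 ∨ (m : ℕ) = 3) := by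
    intro m
    fin_cases m
    all_goals norm_num [Nat.choose, hab]
    all_goals exact hne
  rw [Finset.filter_congr (fun m _ => hP m)]
  decide

/-- the sixfold carrier drop set on the locus `ab = 9c²` (`c ≠ 0`, characteristic `≠ 2`) is `{m : C(3,m) = 3}`: two elements. -/
lemma carrier_drop_six_nine {c a b : K} (hc : c ≠ 0) (h2 : (2 : K) ≠ 0) (hab : a * b = 9 * c ^ 2) :
    (Finset.univ.filter fun m : Fin (3 + 1) => c ^ 2 * (Nat.choose 3 (m : ℕ) : K) ^ 2 = a * b).card = 2 := by
  have hne : ¬ c ^ 2 = 9 * c ^ 2 := fun e => eight_mul_sq_ne_zero hc h2 (by linear_combination -e)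
  have hP : ∀ m : Fin (3 + 1), (c ^ 2 * (Nat.choose 3 (m : ℕ) : K) ^ 2 = a * b) ↔ ((m : ℕ) = 1 ∨ (m : ℕ) = 2) := by
    intro m
    fin_cases m
    all_goals norm_num [Nat.choose, hab]
    all_goals first | exact hne | exact fun e => hne e.symm | ring
  rw [Finset.filter_congr (fun m _ => hP m)]
  decide

variable {V : Type*} [AddCommGroup V] [Module K V] (bV : Basis (Fin ((3 + 3) + (3 + 3))) K V)

/-- **THE WEIL SIXFOLD CARRIER ROW, middle degree, off the loci:** `dim S₃(c·Θ³/3! + a·w₊ + b·w₋) = 112` when `ab ∉ {c², 9c²}`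
(`a, b, c ≠ 0`). [cite: BuchweitzFlenner2008HH, Prop. 6.4.4] -/
theorem finrank_S_carrier_sixfold {c a b : K} (hc : c ≠ 0) (ha : a ≠ 0) (hb : b ≠ 0) (h1 : a * b ≠ c ^ 2)
    (h9 : a * b ≠ 9 * c ^ 2) :
    Module.finrank K (S K (Lsp bV) 3 (Ecl bV (fun i => if i = 3 then c else 0) (3 + 3) + a • wUp bV 3 + b • wLow bV 3)) = 112 := by
  have h := finrank_S_carrier_nn_middle bV (n := 3) (by norm_num) hc ha hb
  rw [carrier_drop_six_generic h1 h9] at h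
  norm_num [Nat.choose] at h
  omega

/-- **THE WEIL SIXFOLD CARRIER ROW on the locus `ab = c²`** (characteristic `≠ 2`): `dim S₃ = 110`. [cite: BuchweitzFlenner2008HH, Prop. 6.4.4] -/
theorem finrank_S_carrier_sixfold_locus_one {c a b : K} (hc : c ≠ 0) (ha : a ≠ 0) (hb : b ≠ 0) (h2 : (2 : K) ≠ 0)
    (hab : a * b = c ^ 2) :
    Module.finrank K (S K (Lsp bV) 3 (Ecl bV (fun i => if i = 3 then c else 0) (3 + 3) + a • wUp bV 3 + b • wLow bV 3)) = 110 := by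
  have h := finrank_S_carrier_nn_middle bV (n := 3) (by norm_num) hc ha hb
  rw [carrier_drop_six_one hc h2 hab] at h
  norm_num [Nat.choose] at h
  omega

/-- **THE WEIL SIXFOLD CARRIER ROW on the locus `ab = 9c²`** (characteristic `≠ 2`): `dim S₃ = 110`. [cite: BuchweitzFlenner2008HH, Prop. 6.4.4] -/
theorem finrank_S_carrier_sixfold_locus_nine {c a b : K} (hc : c ≠ 0) (ha : a ≠ 0) (hb : b ≠ 0) (h2 : (2 : K) ≠ 0)
    (hab : a * b = 9 * c ^ 2) :
    Module.finrank K (S K (Lsp bV) 3 (Ecl bV (fun i => if i = 3 then c else 0) (3 + 3) + a • wUp bV 3 + b • wLow bV 3)) = 110 := by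
  have h := finrank_S_carrier_nn_middle bV (n := 3) (by norm_num) hc ha hb
  rw [carrier_drop_six_nine hc h2 hab] at h
  norm_num [Nat.choose] at h
  omega

end Sixfold

/-! ### 5. The Weil EIGHTFOLD carrier row (`n = 4`): `(1, 16, 104, 304, 480 ∣ 478 ∣ 479, …)` -/

section Eightfold

variable [DecidableEq K]

/-- eightfold carrier drop set, generic: empty. -/
lemma carrier_drop_eight_generic {c a b : K} (h1 : a * b ≠ c ^ 2) (h16 : a * b ≠ 16 * c ^ 2) (h36 : a * b ≠ 36 * c ^ 2) :
    (Finset.univ.filter fun m : Fin (4 + 1) => c ^ 2 * (Nat.choose 4 (m : ℕ) : K) ^ 2 = a * b).card = 0 := by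
  rw [Finset.card_eq_zero, Finset.filter_eq_empty_iff]
  intro m _
  fin_cases m
  all_goals norm_num [Nat.choose]
  all_goals intro e
  all_goals first
    | exact h1 (by linear_combination (-1 : K) * e)
    | exact h16 (by linear_combination (-1 : K) * e)
    | exact h36 (by linear_combination (-1 : K) * e)

section CharZero

variable [CharZero K]

/-- eightfold carrier drop set on `ab = 36c²` (characteristic 0): `{2}`. -/
lemma carrier_drop_eight_36 {c a b : K} (hc : c ≠ 0) (hab : a * b = 36 * c ^ 2) :
    (Finset.univ.filter fun m : Fin (4 + 1) => c ^ 2 * (Nat.choose 4 (m : ℕ) : K) ^ 2 = a * b).card = 1 := by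
  have h35 := natCast_mul_sq_ne_zero hc (k := 35) (by norm_num)
  have h20 := natCast_mul_sq_ne_zero hc (k := 20) (by norm_num)
  push_cast at h35 h20
  have hP : ∀ m : Fin (4 + 1), (c ^ 2 * (Nat.choose 4 (m : ℕ) : K) ^ 2 = a * b) ↔ ((m : ℕ) = 2) := by
    intro m
    fin_cases m
    all_goals norm_num [Nat.choose, hab]
    · exact fun e => h35 (by linear_combination -e)
    · exact fun e => h20 (by linear_combination -e)
    · ring
    · exact fun e => h20 (by linear_combination -e)
    · exact fun e => h35 (by linear_combination -e)
  rw [Finset.filter_congr (fun m _ => hP m)]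
  decide

/-- eightfold carrier drop set on `ab = c²` (characteristic 0): `{0, 4}`. -/
lemma carrier_drop_eight_1 {c a b : K} (hc : c ≠ 0) (hab : a * b = c ^ 2) :
    (Finset.univ.filter fun m : Fin (4 + 1) => c ^ 2 * (Nat.choose 4 (m : ℕ) : K) ^ 2 = a * b).card = 2 := by
  have h35 := natCast_mul_sq_ne_zero hc (k := 35) (by norm_num)
  have h15 := natCast_mul_sq_ne_zero hc (k := 15) (by norm_num)
  push_cast at h35 h15
  have hP : ∀ m : Fin (4 + 1), (c ^ 2 * (Nat.choose 4 (m : ℕ) : K) ^ 2 = a * b) ↔ ((m : ℕ) = 0 ∨ (m : ℕ) = 4) := by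
    intro m
    fin_cases m
    all_goals norm_num [Nat.choose, hab]
    · exact fun e => h15 (by linear_combination e)
    · exact fun e => h35 (by linear_combination e)
    · exact fun e => h15 (by linear_combination e)
  rw [Finset.filter_congr (fun m _ => hP m)]
  decide

/-- eightfold carrier drop set on `ab = 16c²` (characteristic 0): `{1, 3}`. -/
lemma carrier_drop_eight_16 {c a b : K} (hc : c ≠ 0) (hab : a * b = 16 * c ^ 2) :
    (Finset.univ.filter fun m : Fin (4 + 1) => c ^ 2 * (Nat.choose 4 (m : ℕ) : K) ^ 2 = a * b).card = 2 := by
  have h15 := natCast_mul_sq_ne_zero hc (k := 15) (by norm_num)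
  have h20 := natCast_mul_sq_ne_zero hc (k := 20) (by norm_num)
  push_cast at h15 h20
  have hP : ∀ m : Fin (4 + 1), (c ^ 2 * (Nat.choose 4 (m : ℕ) : K) ^ 2 = a * b) ↔ ((m : ℕ) = 1 ∨ (m : ℕ) = 3) := by
    intro m
    fin_cases m
    all_goals norm_num [Nat.choose, hab]
    · exact fun e => h15 (by linear_combination -e)
    · ring
    · exact fun e => h20 (by linear_combination e)
    · ring
    · exact fun e => h15 (by linear_combination -e)
  rw [Finset.filter_congr (fun m _ => hP m)]
  decide

end CharZero

variable {V : Type*} [AddCommGroup V] [Module K V] (bV : Basis (Fin ((4 + 4) + (4 + 4))) K V)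

/-- **THE WEIL EIGHTFOLD CARRIER ROW, middle degree, off the loci:** `dim S₄(c·Θ⁴/4! + a·w₊ + b·w₋) = 480` when
`ab ∉ {c², 16c², 36c²}` (`a, b, c ≠ 0`). [cite: BuchweitzFlenner2008HH, Prop. 6.4.4] -/
theorem finrank_S_carrier_eightfold {c a b : K} (hc : c ≠ 0) (ha : a ≠ 0) (hb : b ≠ 0) (h1 : a * b ≠ c ^ 2)
    (h16 : a * b ≠ 16 * c ^ 2) (h36 : a * b ≠ 36 * c ^ 2) :
    Module.finrank K (S K (Lsp bV) 4 (Ecl bV (fun i => if i = 4 then c else 0) (4 + 4) + a • wUp bV 4 + b • wLow bV 4)) = 480 := by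
  have h := finrank_S_carrier_nn_middle bV (n := 4) (by norm_num) hc ha hb
  rw [carrier_drop_eight_generic h1 h16 h36] at h
  norm_num [Nat.choose] at h
  omega

/-- **THE WEIL EIGHTFOLD CARRIER ROW on the locus `ab = 36c²`** (characteristic `0`): `dim S₄ = 479`. [cite: BuchweitzFlenner2008HH, Prop. 6.4.4] -/
theorem finrank_S_carrier_eightfold_locus_36 [CharZero K] {c a b : K} (hc : c ≠ 0) (ha : a ≠ 0) (hb : b ≠ 0)
    (hab : a * b = 36 * c ^ 2) :
    Module.finrank K (S K (Lsp bV) 4 (Ecl bV (fun i => if i = 4 then c else 0) (4 + 4) + a • wUp bV 4 + b • wLow bV 4)) = 479 := by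
  have h := finrank_S_carrier_nn_middle bV (n := 4) (by norm_num) hc ha hb
  rw [carrier_drop_eight_36 hc hab] at h
  norm_num [Nat.choose] at h
  omega

/-- **THE WEIL EIGHTFOLD CARRIER ROW on the locus `ab = c²`** (characteristic `0`): `dim S₄ = 478`. [cite: BuchweitzFlenner2008HH, Prop. 6.4.4] -/
theorem finrank_S_carrier_eightfold_locus_1 [CharZero K] {c a b : K} (hc : c ≠ 0) (ha : a ≠ 0) (hb : b ≠ 0)
    (hab : a * b = c ^ 2) :
    Module.finrank K (S K (Lsp bV) 4 (Ecl bV (fun i => if i = 4 then c else 0) (4 + 4) + a • wUp bV 4 + b • wLow bV 4)) = 478 := by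
  have h := finrank_S_carrier_nn_middle bV (n := 4) (by norm_num) hc ha hb
  rw [carrier_drop_eight_1 hc hab] at h
  norm_num [Nat.choose] at h
  omega

/-- **THE WEIL EIGHTFOLD CARRIER ROW on the locus `ab = 16c²`** (characteristic `0`): `dim S₄ = 478`. [cite: BuchweitzFlenner2008HH, Prop. 6.4.4] -/
theorem finrank_S_carrier_eightfold_locus_16 [CharZero K] {c a b : K} (hc : c ≠ 0) (ha : a ≠ 0) (hb : b ≠ 0)
    (hab : a * b = 16 * c ^ 2) :
    Module.finrank K (S K (Lsp bV) 4 (Ecl bV (fun i => if i = 4 then c else 0) (4 + 4) + a • wUp bV 4 + b • wLow bV 4)) = 478 := by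
  have h := finrank_S_carrier_nn_middle bV (n := 4) (by norm_num) hc ha hb
  rw [carrier_drop_eight_16 hc hab] at h
  norm_num [Nat.choose] at h
  omega

end Eightfold


end Summit.Ventures.HSemireg.Mod4Carrier
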